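import Summits.BirchSwinnertonDyer.BirchSwinnertonDyer.Theorems.EisensteinPrimesX2AnalyticLambdaCertificate
import Summits.BirchSwinnertonDyer.Rank1Residual.Iwasawa.LambdaInvariantValuationResultant
import Literature.NumberTheory.EllipticCurves.CyclotomicInterpolantUniquenessProofs
import HarnessLib

/-!
# Route `EisensteinPrimes`, line `mudescent`, crux 3 `MazurMCOnCellB`: the analytic inputs of stubs
# 3 + 4 at a pair IN EXACT RATIONAL ARITHMETIC — one Sylvester resultant of the Mazur–Tate element
# decides `μ_an = 0 ∧ λ_an = V`, character-free (helper; closes nothing)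

Seat `bsd-eis-lam-a` g4 (PROGRAMME PART 1b, ACCEL-LIST (4): "ANALYTIC side of
`stub_lambdaCount_offLocus`"; items stmt-BirchSwinnertonDyer-19033 / -19035; skeleton owner
bsd-eis-ky, `Lines/mudescent.lean`). Sequel of g3's `EisensteinPrimesX2AnalyticLambdaCertificate`
(p485207: ONE Birch sum `|ϖ·∑_a χ(a)[a/p^{n+1+e₀}]⁺_f|^{φ(pⁿ⁺¹)} = p^{−V}` for ONE `ℂ_p`-valued
character `χ` ⇒ `X2.AnalyticMuLE W p 0 ∧ X2.AnalyticLambdaEq W p V`) and of b2b's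
`Iwasawa/LambdaInvariantValuationResultant` (the orbit product of a RATIONAL POLYNOMIAL over the
primitive `pⁿ⁺¹`-th roots of unity is a Sylvester resultant over `ℚ`; stated there for the
`(μ, λ)` of the Mazur–Tate element ITSELF, and without a consumer in the tree).

HONEST FRAMING. THEOREMS ONLY — no definition, no new named fact; nothing about any particular
curve is asserted; closes nothing; moves no label. Class-wide, `stub_lambdaCount_offLocus` stays
crux-sized (lam-a g0 CENSUS, g2 MEMO-2 §4: no function of GV-type local data computes `λ_an` on
`¬GVPar` rows). What this file adds is the form of the PER-PAIR analytic certificate that needs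
neither a `ℂ_p`-valued character nor a `p`-adic embedding of a cyclotomic number in its hypothesis:

* §1 (any `(f, α, L)` with the Mazur–Tate–Teitelbaum twisted interpolation clause and
  `‖α⁻¹‖ = 1`, integral model `ι(G) = ϖ·L`): for every layer `n + 1`,
  **`∏_{ζ of order pⁿ⁺¹} ‖G(ζ − 1)‖ = ‖ϖ‖^{φ(pⁿ⁺¹)} · ‖R_{n+1}‖_p`**, where
  `R_{n+1} := Res(Φ_{pⁿ⁺¹}(X + 1), θ_{n+1}(f)) ∈ ℚ` is the Sylvester resultant of the tree's
  Mazur–Tate element `θ_{n+1}(f) = mazurTateElement f p (n + 1) ∈ ℚ[X]` (degree parameters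
  `φ(pⁿ⁺¹)`, `deg θ_{n+1}`): at EVERY primitive `ζ` there is a character `χ` of `Γ` with `χ(γ) = ζ`
  (`exists_character_apply_cyclotomicGenerator_eq`), `G(ζ − 1) = ϖ·α^{−(n+1+e₀)}·∑_a χ(a)[a/p^{n+1+e₀}]⁺_f`
  (interpolation) `= ϖ·α^{−(n+1+e₀)}·θ_{n+1}(ζ − 1)` (`eval₂_mazurTateElement_eq_ratTwistedSymbolSum`),
  and `∏_ζ θ_{n+1}(ζ − 1) = ι(R_{n+1})` (`prod_eval₂_sub_one_eq_algebraMap_resultant`). Hence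
  (`Iwasawa.mu_eq_zero_and_lam_eq_of_prod_norm_tsum_eq`) **`‖ϖ‖^φ·‖R‖_p = p^{−V}` with
  `V < φ(pⁿ⁺¹)` ⟹ `μ(G) = 0 ∧ λ(G) = V`**; conversely `λ(G) < φ(pⁿ⁺¹)` ⟹
  `‖ϖ‖^φ·‖R‖_p = p^{−(φ·μ(G) + λ(G))}`; and the undetermined regime
  `‖ϖ‖^φ·‖R‖_p ≤ p^{−φ} ↔ μ(G) ≥ 1 ∨ λ(G) ≥ φ(pⁿ⁺¹)`.
* §2 X2 currency (odd multiplicative `p`, THE datum `(f, ϖ, L)` of `X2.AnalyticMuLE` /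
  `X2.AnalyticLambdaEq`, `α = ±1`): `‖ϖ‖^φ·‖R‖_p = p^{−V}`, `V < φ` ⟹
  `X2.AnalyticMuLE W p 0 ∧ X2.AnalyticLambdaEq W p V`; the `padicValRat` form
  `φ(pⁿ⁺¹)·v_p(ϖ) + v_p(R_{n+1}) = V`, `R_{n+1} ≠ 0`; and the `L`-free, `G`-free form at a
  reducible multiplicative odd `p` (integral model from Wuthrich 2014 Thm. 16 via g0's
  `exists_data`; `f`, `ϖ` pinned by strong multiplicity one and `Ω_W ≠ 0`).
The compositions of g3 re-fed from `R` (stubs 3 + 4 at the pair, Mazur's main conjecture at the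
pair, END-TO-END at a type-A split étale end) are in the companion file
`EisensteinPrimesX2LambdaCountFromResultant`.

WHY THIS CURRENCY (numbers, HOME/lam-a-g4/lam-a-MEMO-4.md): (i) `R_{n+1}` is ONE rational number
computed from the `(p − 1)·pⁿ⁺¹` rational modular symbols `[a/p^{n+1+e₀}]⁺_f` by a determinant — no
rounding, no `p`-adic expansion, no choice of `χ`; at `p = 3`, `n + 1 = 2` it decides every
`λ_an ≤ 5` (MEMO-2 §4: 50 of the 51 sampled type-A split lines). (ii) Lei–Pollack et al.,
arXiv:2512.00525, Thm. 1: at a curve with `ord_p(L(E,1)/Ω_E) < 0` — e.g. a type-A étale end `W₀`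
with rational `p`-torsion and `p ∤ #Ш·∏c_ℓ` — the Mazur–Tate elements `θ_m(W₀)` have
`λ(θ_m) = p^m − 1` (MAXIMAL) at EVERY `m`, so an instrument that reads "`λ` of the Mazur–Tate
element" never reaches `λ(L_p)` on such classes; `R_{n+1}` sees only the PRIMITIVE characters of the
layer, where `θ_{n+1}(ζ − 1) = α^{n+1+e₀}·L(ζ − 1)` exactly, and is immune.

References: [MazurTateTeitelbaum1986Invent] §I.8 (8.6), §I.12–I.14; [Washington1997] §7.1–7.2,
Thm. 7.3; [Pollack2003] Def. 6.15, Prop. 6.9; [Wuthrich2014] Thm. 16;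
HOME/lam-a-g2/lam-a-MEMO-2.md §4; HOME/lam-a-g3/lam-a-MEMO-3.md §1.
-/

set_option linter.dupNamespace false
set_option autoImplicit false

noncomputable section

open scoped Classical MatrixGroups ModularForm

open CongruenceSubgroup WeierstrassCurve NumberField IsDedekindDomain
  Literature.NumberTheory.EllipticCurves
  Literature.NumberTheory.EllipticCurves.ModularForms
  Literature.NumberTheory.EllipticCurves.Rank1Residual
  Literature.NumberTheory.EllipticCurves.GreenbergVatsal2000
  Literature.NumberTheory.EllipticCurves.Wuthrich2014
  Literature.NumberTheory.GaloisCohomology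
  Summit.BirchSwinnertonDyer.Rank1Residual
  Summit.BirchSwinnertonDyer.Rank1Residual.X1.MuLambda
  Summit.BirchSwinnertonDyer.Rank1Residual.X1.TamagawaSqueeze
  Summit.BirchSwinnertonDyer.Rank1Residual.X11a
  Summit.BirchSwinnertonDyer.Rank1Residual.Iwasawa
  Summit.BirchSwinnertonDyer.BirchSwinnertonDyer.Theorems.EisensteinPrimesAnalyticLambdaCalculus
  Summit.BirchSwinnertonDyer.BirchSwinnertonDyer.Theorems.EisensteinPrimesX2AnalyticLambdaCertificate

namespace Summit.BirchSwinnertonDyer.BirchSwinnertonDyer.Theorems.EisensteinPrimesX2AnalyticLambdaResultantCertificate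

variable {p : ℕ} [hp : Fact p.Prime]

/-! ## §1. The orbit product of an integral model of `ϖ·L` is `‖ϖ‖^φ · ‖Res(Φ_{pⁿ⁺¹}(X+1), θ_{n+1})‖` -/

section Orbit

variable {N : ℕ} {f : CuspForm (Gamma0 N) 2}

omit hp in
/-- A primitive `pⁿ⁺¹`-th root of unity exists in `ℂ_p` (algebraically closed of characteristic
`0`: a root of `Φ_{pⁿ⁺¹}`). [folklore] -/
theorem exists_isPrimitiveRoot_padicComplex [Fact p.Prime] (n : ℕ) :
    ∃ ζ₀ : ℂ_[p], IsPrimitiveRoot ζ₀ (p ^ (n + 1)) := by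
  have hpos : 0 < p ^ (n + 1) := pow_pos (Fact.out : p.Prime).pos _
  haveI : NeZero ((p ^ (n + 1) : ℕ) : ℂ_[p]) := ⟨by exact_mod_cast hpos.ne'⟩
  have hdeg : (Polynomial.cyclotomic (p ^ (n + 1)) ℂ_[p]).degree ≠ 0 := by
    rw [Polynomial.degree_cyclotomic]
    exact_mod_cast (Nat.totient_pos.mpr hpos).ne'
  obtain ⟨ζ₀, hζ₀⟩ := IsAlgClosed.exists_root _ hdeg
  exact ⟨ζ₀, Polynomial.isRoot_cyclotomic_iff.mp hζ₀⟩

/-- **The orbit product is `‖ϖ‖^φ·‖resultant‖`.** `L ∈ ℚ_p⟦T⟧` with the twisted interpolation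
clause `hI` for `(f, α)`, `‖α⁻¹^k‖ = 1`, integral model `ι(G) = ϖ·L`. Then for every layer,
`∏_{ζ of order pⁿ⁺¹} ‖G(ζ − 1)‖ = ‖ϖ‖^{φ(pⁿ⁺¹)} · ‖Res(Φ_{pⁿ⁺¹}(X+1), θ_{n+1}(f))‖_p`: at each
primitive `ζ` pick the character `χ` of `Γ` of conductor `p^{n+1+e₀}` with `χ(γ) = ζ`; then
`G(ζ − 1) = ϖ·α^{−(n+1+e₀)}·∑_a χ(a)[a/p^{n+1+e₀}]⁺_f = ϖ·α^{−(n+1+e₀)}·θ_{n+1}(ζ − 1)`, and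
`∏_ζ θ_{n+1}(ζ − 1)` is the rational resultant. [cite: MazurTateTeitelbaum1986Invent, §I.13–I.14]
[cite: Pollack2003, Prop. 6.9 (proof)] -/
theorem prod_norm_tsum_eq_norm_pow_mul_norm_resultant {α : ℚ_[p]} {L : PowerSeries ℚ_[p]}
    (hI : ∀ (m : ℕ), 0 < m → ∀ χ : DirichletCharacter ℂ_[p] (p ^ m), χ.IsPrimitive → χ.Even →
      (∃ j : ℕ, orderOf χ = p ^ j) →
        HasSum (fun k : ℕ ↦ algebraMap ℚ_[p] ℂ_[p] (PowerSeries.coeff k L) *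
            (χ (cyclotomicGenerator p : ZMod (p ^ m)) - 1) ^ k)
          (algebraMap ℚ_[p] ℂ_[p] (α⁻¹ ^ m) * ratTwistedSymbolSum f χ))
    (hα : ∀ k : ℕ, ‖algebraMap ℚ_[p] ℂ_[p] (α⁻¹ ^ k)‖ = 1)
    {G : IwasawaAlgebra p} {ϖ : ℚ_[p]} (hG : iwasawaToPowerSeries p G = PowerSeries.C ϖ * L)
    {n : ℕ} {ζ₀ : ℂ_[p]} (hζ₀ : IsPrimitiveRoot ζ₀ (p ^ (n + 1))) :
    ∏ ζ ∈ primitiveRoots (p ^ (n + 1)) ℂ_[p],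
      ‖∑' k, ((algebraMap ℚ_[p] ℂ_[p]).comp (algebraMap ℤ_[p] ℚ_[p])) (PowerSeries.coeff k G) *
        (ζ - 1) ^ k‖ =
      ‖ϖ‖ ^ Nat.totient (p ^ (n + 1)) *
        ‖((Polynomial.resultant ((Polynomial.cyclotomic (p ^ (n + 1)) ℚ).comp (Polynomial.X + 1))
            (mazurTateElement f p (n + 1)) (Nat.totient (p ^ (n + 1)))
            (mazurTateElement f p (n + 1)).natDegree : ℚ) : ℚ_[p])‖ := by
  have hpos : 0 < p ^ (n + 1) := pow_pos hp.out.pos _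
  -- each factor: `‖G(ζ - 1)‖ = ‖ϖ‖ · ‖θ_{n+1}(ζ - 1)‖`
  have hfac : ∀ ζ ∈ primitiveRoots (p ^ (n + 1)) ℂ_[p],
      ‖∑' k, ((algebraMap ℚ_[p] ℂ_[p]).comp (algebraMap ℤ_[p] ℚ_[p])) (PowerSeries.coeff k G) *
        (ζ - 1) ^ k‖ =
        ‖ϖ‖ * ‖(mazurTateElement f p (n + 1)).eval₂ (algebraMap ℚ ℂ_[p]) (ζ - 1)‖ := by
    intro ζ hζ
    rw [mem_primitiveRoots hpos] at hζ
    obtain ⟨χ, hχ, heven, hord, hχγ⟩ := exists_character_apply_cyclotomicGenerator_eq (p := p) n hζ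
    have hm : 0 < n + 1 + cyclotomicExponent p := by omega
    have hsum := hasSum_integralModel_eq_ratTwistedSymbolSum hI hG hm χ hχ heven hord
    have hθ := eval₂_mazurTateElement_eq_ratTwistedSymbolSum f (p := p) χ heven hord
    rw [hχγ] at hsum hθ
    rw [hsum.tsum_eq, ← hθ, norm_mul, norm_mul, hα, one_mul, norm_algebraMap']
  rw [Finset.prod_congr rfl hfac, Finset.prod_mul_distrib, Finset.prod_const,
    hζ₀.card_primitiveRoots, ← norm_prod,
    ← prod_eval₂_sub_one_eq_algebraMap_resultant _ hζ₀, norm_algebraMap_rat]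

/-- **Converse direction (what the instrument must find).** If `λ(G) < φ(pⁿ⁺¹)` then
`‖ϖ‖^{φ(pⁿ⁺¹)} · ‖Res(Φ_{pⁿ⁺¹}(X+1), θ_{n+1})‖_p = p^{−(φ(pⁿ⁺¹)·μ(G) + λ(G))}`.
[cite: Washington1997, §7.1–7.2 and Thm. 7.3] [cite: MazurTateTeitelbaum1986Invent, §I.13–I.14] -/
theorem norm_pow_mul_norm_resultant_eq_of_lam_lt_totient {α : ℚ_[p]} {L : PowerSeries ℚ_[p]}
    (hI : ∀ (m : ℕ), 0 < m → ∀ χ : DirichletCharacter ℂ_[p] (p ^ m), χ.IsPrimitive → χ.Even →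
      (∃ j : ℕ, orderOf χ = p ^ j) →
        HasSum (fun k : ℕ ↦ algebraMap ℚ_[p] ℂ_[p] (PowerSeries.coeff k L) *
            (χ (cyclotomicGenerator p : ZMod (p ^ m)) - 1) ^ k)
          (algebraMap ℚ_[p] ℂ_[p] (α⁻¹ ^ m) * ratTwistedSymbolSum f χ))
    (hα : ∀ k : ℕ, ‖algebraMap ℚ_[p] ℂ_[p] (α⁻¹ ^ k)‖ = 1)
    {G : IwasawaAlgebra p} {ϖ : ℚ_[p]} (hG : iwasawaToPowerSeries p G = PowerSeries.C ϖ * L)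
    (hG0 : G ≠ 0) {n : ℕ} (hlam : lam G < Nat.totient (p ^ (n + 1))) :
    ‖ϖ‖ ^ Nat.totient (p ^ (n + 1)) *
        ‖((Polynomial.resultant ((Polynomial.cyclotomic (p ^ (n + 1)) ℚ).comp (Polynomial.X + 1))
            (mazurTateElement f p (n + 1)) (Nat.totient (p ^ (n + 1)))
            (mazurTateElement f p (n + 1)).natDegree : ℚ) : ℚ_[p])‖ =
      ((p : ℝ)⁻¹) ^ (Nat.totient (p ^ (n + 1)) * mu G + lam G) := by
  obtain ⟨ζ₀, hζ₀⟩ := exists_isPrimitiveRoot_padicComplex (p := p) n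
  rw [← prod_norm_tsum_eq_norm_pow_mul_norm_resultant hI hα hG hζ₀]
  exact prod_norm_tsum_eq_of_lam_lt_totient hG0 hζ₀ hlam

/-- **THE CERTIFICATE, character-free.** If `‖ϖ‖^{φ(pⁿ⁺¹)} · ‖Res(Φ_{pⁿ⁺¹}(X+1), θ_{n+1})‖_p
= p^{−V}` with `V < φ(pⁿ⁺¹)`, then `μ(G) = 0` and `λ(G) = V`.
[cite: Washington1997, §7.1–7.2 and Thm. 7.3] [cite: MazurTateTeitelbaum1986Invent, §I.13–I.14] -/
theorem mu_eq_zero_and_lam_eq_of_norm_pow_mul_norm_resultant_eq {α : ℚ_[p]}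
    {L : PowerSeries ℚ_[p]}
    (hI : ∀ (m : ℕ), 0 < m → ∀ χ : DirichletCharacter ℂ_[p] (p ^ m), χ.IsPrimitive → χ.Even →
      (∃ j : ℕ, orderOf χ = p ^ j) →
        HasSum (fun k : ℕ ↦ algebraMap ℚ_[p] ℂ_[p] (PowerSeries.coeff k L) *
            (χ (cyclotomicGenerator p : ZMod (p ^ m)) - 1) ^ k)
          (algebraMap ℚ_[p] ℂ_[p] (α⁻¹ ^ m) * ratTwistedSymbolSum f χ))
    (hα : ∀ k : ℕ, ‖algebraMap ℚ_[p] ℂ_[p] (α⁻¹ ^ k)‖ = 1)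
    {G : IwasawaAlgebra p} {ϖ : ℚ_[p]} (hG : iwasawaToPowerSeries p G = PowerSeries.C ϖ * L)
    (hG0 : G ≠ 0) {n V : ℕ} (hV : V < Nat.totient (p ^ (n + 1)))
    (h : ‖ϖ‖ ^ Nat.totient (p ^ (n + 1)) *
        ‖((Polynomial.resultant ((Polynomial.cyclotomic (p ^ (n + 1)) ℚ).comp (Polynomial.X + 1))
            (mazurTateElement f p (n + 1)) (Nat.totient (p ^ (n + 1)))
            (mazurTateElement f p (n + 1)).natDegree : ℚ) : ℚ_[p])‖ = ((p : ℝ)⁻¹) ^ V) :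
    mu G = 0 ∧ lam G = V := by
  obtain ⟨ζ₀, hζ₀⟩ := exists_isPrimitiveRoot_padicComplex (p := p) n
  exact mu_eq_zero_and_lam_eq_of_prod_norm_tsum_eq hG0 hζ₀ hV
    ((prod_norm_tsum_eq_norm_pow_mul_norm_resultant hI hα hG hζ₀).trans h)

/-- **The undetermined regime.** Outside `μ(G) = 0 ∧ λ(G) < φ(pⁿ⁺¹)` the certificate value is
`≤ p^{−φ(pⁿ⁺¹)}`; precisely `‖ϖ‖^φ · ‖Res‖_p ≤ p^{−φ(pⁿ⁺¹)} ↔ μ(G) ≥ 1 ∨ λ(G) ≥ φ(pⁿ⁺¹)` (so a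
value `p^{−V}` with `V < φ` is conclusive, and a value `≤ p^{−φ}` says "go one layer up").
[cite: Washington1997, §7.1–7.2 and Thm. 7.3] -/
theorem norm_pow_mul_norm_resultant_le_iff {α : ℚ_[p]} {L : PowerSeries ℚ_[p]}
    (hI : ∀ (m : ℕ), 0 < m → ∀ χ : DirichletCharacter ℂ_[p] (p ^ m), χ.IsPrimitive → χ.Even →
      (∃ j : ℕ, orderOf χ = p ^ j) →
        HasSum (fun k : ℕ ↦ algebraMap ℚ_[p] ℂ_[p] (PowerSeries.coeff k L) *
            (χ (cyclotomicGenerator p : ZMod (p ^ m)) - 1) ^ k)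
          (algebraMap ℚ_[p] ℂ_[p] (α⁻¹ ^ m) * ratTwistedSymbolSum f χ))
    (hα : ∀ k : ℕ, ‖algebraMap ℚ_[p] ℂ_[p] (α⁻¹ ^ k)‖ = 1)
    {G : IwasawaAlgebra p} {ϖ : ℚ_[p]} (hG : iwasawaToPowerSeries p G = PowerSeries.C ϖ * L)
    (hG0 : G ≠ 0) {n : ℕ} :
    ‖ϖ‖ ^ Nat.totient (p ^ (n + 1)) *
        ‖((Polynomial.resultant ((Polynomial.cyclotomic (p ^ (n + 1)) ℚ).comp (Polynomial.X + 1))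
            (mazurTateElement f p (n + 1)) (Nat.totient (p ^ (n + 1)))
            (mazurTateElement f p (n + 1)).natDegree : ℚ) : ℚ_[p])‖ ≤
        ((p : ℝ)⁻¹) ^ Nat.totient (p ^ (n + 1)) ↔
      1 ≤ mu G ∨ Nat.totient (p ^ (n + 1)) ≤ lam G := by
  obtain ⟨ζ₀, hζ₀⟩ := exists_isPrimitiveRoot_padicComplex (p := p) n
  obtain ⟨hq0, hq1⟩ := inv_prime_pos_and_lt_one (p := p)
  rw [← prod_norm_tsum_eq_norm_pow_mul_norm_resultant hI hα hG hζ₀]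
  constructor
  · intro hle
    by_contra hcon
    rw [not_or, not_le, not_le, Nat.lt_one_iff] at hcon
    obtain ⟨hμ, hlam⟩ := hcon
    have heq := prod_norm_tsum_eq_of_lam_lt_totient hG0 hζ₀ hlam
    rw [hμ, mul_zero, zero_add] at heq
    rw [heq] at hle
    exact absurd ((pow_lt_pow_iff_right_of_lt_one₀ hq0 hq1).mpr hlam) (not_lt.mpr hle)
  · intro hor
    have hnot : ¬ (mu G = 0 ∧ lam G < Nat.totient (p ^ (n + 1))) := by
      rintro ⟨hμ, hlam⟩
      rcases hor with h1 | h2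
      · omega
      · omega
    exact prod_norm_tsum_le_of_not hG0 hζ₀ hnot

end Orbit

/-! ## §2. X2 currency: the resultant certificate gives the typed analytic inputs of stubs 3 + 4 -/

section X2Certificate

variable {W : WeierstrassCurve ℚ} [W.IsElliptic] [W.IsGloballyMinimal]
  {N : ℕ} [NeZero N] {f : CuspForm (Gamma0 N) 2} {ϖ : ℚ} {L : PowerSeries ℚ_[p]}

/-- A rational number `r ≠ 0` with `padicValRat p r = m` (`m ∈ ℕ`) has `‖(r : ℚ_p)‖ = p^{−m}`.
[folklore] -/
theorem norm_ratCast_eq_of_padicValRat_eq {r : ℚ} (hr : r ≠ 0) {m : ℕ}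
    (h : padicValRat p r = m) : ‖(r : ℚ_[p])‖ = ((p : ℝ)⁻¹) ^ m := by
  rw [Padic.eq_padicNorm, padicNorm.eq_zpow_of_nonzero hr, h]
  push_cast
  rw [inv_pow, ← zpow_natCast, ← zpow_neg]

/-- **X2: the RESULTANT CERTIFICATE gives `μ_an = 0` AND `λ_an`.** For one datum `(f, ϖ, L)` of
`X2.AnalyticMuLE` / `X2.AnalyticLambdaEq` at an odd multiplicative `p` (THE Mazur–Tate–Teitelbaum
function read through the split / non-split dichotomy, `α = ±1`) with an integral model
`ι(G) = ϖ·L`: if `‖ϖ‖^{φ(pⁿ⁺¹)} · ‖Res(Φ_{pⁿ⁺¹}(X+1), θ_{n+1}(f))‖_p = p^{−V}` with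
`V < φ(pⁿ⁺¹)`, then `X2.AnalyticMuLE W p 0 ∧ X2.AnalyticLambdaEq W p V`. No character and no `p`-adic
embedding of a cyclotomic number occurs in the hypothesis: `Res` is a rational determinant of the
modular symbols `[a/p^{n+1+e₀}]⁺_f`. [cite: MazurTateTeitelbaum1986Invent, §I.13–I.14]
[cite: Washington1997, §7.1–7.2 and Thm. 7.3] [cite: Pollack2003, Def. 6.15 and Prop. 6.9] -/
theorem analyticMuLE_zero_and_analyticLambdaEq_of_norm_resultant_eq (hf : IsNewformOf W f)
    (hϖ : (ϖ : ℝ) * W.realPeriodRat = plusPeriod f)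
    (hLs : W.HasSplitMultiplicativeReductionAtPrime p → IsSplitMultPAdicLFunctionOf f p L)
    (hLn : ¬ W.HasSplitMultiplicativeReductionAtPrime p → IsMultPAdicLFunctionOf f p (-1) L)
    {G : IwasawaAlgebra p} (hG : iwasawaToPowerSeries p G = PowerSeries.C ((ϖ : ℚ) : ℚ_[p]) * L)
    {n V : ℕ} (hV : V < Nat.totient (p ^ (n + 1)))
    (h : ‖((ϖ : ℚ) : ℚ_[p])‖ ^ Nat.totient (p ^ (n + 1)) *
        ‖((Polynomial.resultant ((Polynomial.cyclotomic (p ^ (n + 1)) ℚ).comp (Polynomial.X + 1))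
            (mazurTateElement f p (n + 1)) (Nat.totient (p ^ (n + 1)))
            (mazurTateElement f p (n + 1)).natDegree : ℚ) : ℚ_[p])‖ = ((p : ℝ)⁻¹) ^ V) :
    X2.AnalyticMuLE W p 0 ∧ X2.AnalyticLambdaEq W p V := by
  obtain ⟨α, hα, hI⟩ := exists_interpolation_of_dichotomy (W := W) hLs hLn
  have hpV : (0 : ℝ) < ((p : ℝ)⁻¹) ^ V :=
    pow_pos (inv_pos.mpr (by exact_mod_cast hp.out.pos)) V
  -- `G ≠ 0`: otherwise the orbit product vanishes, but `p^{-V} ≠ 0`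
  have hG0 : G ≠ 0 := by
    intro hG0
    obtain ⟨ζ₀, hζ₀⟩ := exists_isPrimitiveRoot_padicComplex (p := p) n
    have hprod := prod_norm_tsum_eq_norm_pow_mul_norm_resultant hI hα hG hζ₀
    rw [h, hG0] at hprod
    have hzero : ∏ ζ ∈ primitiveRoots (p ^ (n + 1)) ℂ_[p],
        ‖∑' k, ((algebraMap ℚ_[p] ℂ_[p]).comp (algebraMap ℤ_[p] ℚ_[p]))
          (PowerSeries.coeff k (0 : IwasawaAlgebra p)) * (ζ - 1) ^ k‖ = 0 := by
      rw [Finset.prod_eq_zero_iff]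
      refine ⟨ζ₀, (mem_primitiveRoots (pow_pos hp.out.pos _)).mpr hζ₀, ?_⟩
      simp
    rw [hzero] at hprod
    exact absurd hprod hpV.ne
  obtain ⟨hμ, hlam⟩ := mu_eq_zero_and_lam_eq_of_norm_pow_mul_norm_resultant_eq hI hα hG hG0 hV h
  -- `μ(G) = 0`: some coefficient of `G`, i.e. of `ϖ·L`, is a unit
  have hunit : HasUnitContent G := hasUnitContent_of_mu_eq_zero hG0 hμ
  obtain ⟨k, hk⟩ := (hasUnitContent_iff_exists_norm_eq_one G).mp hunit
  rw [norm_coeff_eq_of_iota_eq hG] at hk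
  refine ⟨analyticMuLE_zero_of_norm_coeff_eq_one hf hϖ hLs hLn hk,
    (analyticLambdaEq_iff_of_datum hf hϖ hLs hLn V).mpr fun G' hG' ↦ ?_⟩
  rw [iwasawaToPowerSeries_injective p (hG'.trans hG.symm), hlam]

/-- **`padicValRat` form**: `Res ≠ 0` and `φ(pⁿ⁺¹)·v_p(ϖ) + v_p(Res(Φ_{pⁿ⁺¹}(X+1), θ_{n+1}(f))) = V`
with `V < φ(pⁿ⁺¹)` ⟹ `X2.AnalyticMuLE W p 0 ∧ X2.AnalyticLambdaEq W p V` — the certificate in exact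
rational arithmetic (`ϖ ≠ 0` by `Ω⁺_f > 0`). [cite: MazurTateTeitelbaum1986Invent, §I.13–I.14]
[cite: Washington1997, §7.1–7.2 and Thm. 7.3] -/
theorem analyticMuLE_zero_and_analyticLambdaEq_of_padicValRat_resultant_eq (hf : IsNewformOf W f)
    (hϖ : (ϖ : ℝ) * W.realPeriodRat = plusPeriod f)
    (hLs : W.HasSplitMultiplicativeReductionAtPrime p → IsSplitMultPAdicLFunctionOf f p L)
    (hLn : ¬ W.HasSplitMultiplicativeReductionAtPrime p → IsMultPAdicLFunctionOf f p (-1) L)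
    {G : IwasawaAlgebra p} (hG : iwasawaToPowerSeries p G = PowerSeries.C ((ϖ : ℚ) : ℚ_[p]) * L)
    {n V : ℕ} (hV : V < Nat.totient (p ^ (n + 1)))
    (hR : Polynomial.resultant ((Polynomial.cyclotomic (p ^ (n + 1)) ℚ).comp (Polynomial.X + 1))
        (mazurTateElement f p (n + 1)) (Nat.totient (p ^ (n + 1)))
        (mazurTateElement f p (n + 1)).natDegree ≠ 0)
    (h : (Nat.totient (p ^ (n + 1)) : ℤ) * padicValRat p ϖ +
        padicValRat p (Polynomial.resultant
          ((Polynomial.cyclotomic (p ^ (n + 1)) ℚ).comp (Polynomial.X + 1))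
          (mazurTateElement f p (n + 1)) (Nat.totient (p ^ (n + 1)))
          (mazurTateElement f p (n + 1)).natDegree) = V) :
    X2.AnalyticMuLE W p 0 ∧ X2.AnalyticLambdaEq W p V := by
  obtain ⟨hϖ0, -⟩ := varpi_ne_zero_and_realPeriodRat_ne_zero hf hϖ
  set R := Polynomial.resultant ((Polynomial.cyclotomic (p ^ (n + 1)) ℚ).comp (Polynomial.X + 1))
    (mazurTateElement f p (n + 1)) (Nat.totient (p ^ (n + 1)))
    (mazurTateElement f p (n + 1)).natDegree with hRdef
  have hr : ϖ ^ Nat.totient (p ^ (n + 1)) * R ≠ 0 := mul_ne_zero (pow_ne_zero _ hϖ0) hR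
  have hv : padicValRat p (ϖ ^ Nat.totient (p ^ (n + 1)) * R) = V := by
    rw [padicValRat.mul (pow_ne_zero _ hϖ0) hR, padicValRat.pow ϖ]
    exact h
  have hnorm := norm_ratCast_eq_of_padicValRat_eq (p := p) hr hv
  rw [Rat.cast_mul, Rat.cast_pow, norm_mul, norm_pow] at hnorm
  exact analyticMuLE_zero_and_analyticLambdaEq_of_norm_resultant_eq hf hϖ hLs hLn hG hV hnorm

/-- **`L`-free, `G`-free form at a reducible multiplicative odd `p`.** The integral model is SUPPLIED
by Wuthrich 2014 Thm. 16 (`hWu`) and modularity (`hpar`) through g0's `exists_data`; the newform is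
pinned by strong multiplicity one across levels and `ϖ` by `Ω_W ≠ 0`. So the display hypothesis is:
a newform `f` of `W`, its `ϖ`, and ONE rational valuation identity.
[cite: Wuthrich2014, Thm. 16 (p. 397)] [cite: MazurTateTeitelbaum1986Invent, §I.13–I.14] -/
theorem analyticMuLE_zero_and_analyticLambdaEq_of_padicValRat_resultant_eq_of_red
    (hWu : thm16_charIdeal_dvd_multiplicative_of_reducible) (hpar : nonempty_modularParametrizationData)
    (hp2 : p ≠ 2) (hmult : W.HasMultiplicativeReductionAtPrime p)
    (hred : ¬ W.HasIrreducibleModPGaloisRep p) (hf : IsNewformOf W f)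
    (hϖ : (ϖ : ℝ) * W.realPeriodRat = plusPeriod f) {n V : ℕ} (hV : V < Nat.totient (p ^ (n + 1)))
    (hR : Polynomial.resultant ((Polynomial.cyclotomic (p ^ (n + 1)) ℚ).comp (Polynomial.X + 1))
        (mazurTateElement f p (n + 1)) (Nat.totient (p ^ (n + 1)))
        (mazurTateElement f p (n + 1)).natDegree ≠ 0)
    (h : (Nat.totient (p ^ (n + 1)) : ℤ) * padicValRat p ϖ +
        padicValRat p (Polynomial.resultant
          ((Polynomial.cyclotomic (p ^ (n + 1)) ℚ).comp (Polynomial.X + 1))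
          (mazurTateElement f p (n + 1)) (Nat.totient (p ^ (n + 1)))
          (mazurTateElement f p (n + 1)).natDegree) = V) :
    X2.AnalyticMuLE W p 0 ∧ X2.AnalyticLambdaEq W p V := by
  obtain ⟨N', _, f', ϖ', L', G, hf', hϖ', hLs', hLn', hG⟩ :=
    EisensteinPrimesAnalyticLambdaCalculus.exists_data hWu hpar hp2 hmult hred
  obtain rfl : N = N' := hf.level_eq_level hf'
  obtain rfl : f = f' := hf.unique hf'
  obtain ⟨-, hΩ⟩ := varpi_ne_zero_and_realPeriodRat_ne_zero hf hϖ
  obtain rfl : ϖ' = ϖ := by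
    have h2 : (ϖ' : ℝ) * W.realPeriodRat = (ϖ : ℝ) * W.realPeriodRat := by rw [hϖ', hϖ]
    exact_mod_cast mul_right_cancel₀ hΩ h2
  exact analyticMuLE_zero_and_analyticLambdaEq_of_padicValRat_resultant_eq hf hϖ' hLs' hLn' hG hV
    hR h

end X2Certificate


end Summit.BirchSwinnertonDyer.BirchSwinnertonDyer.Theorems.EisensteinPrimesX2AnalyticLambdaResultantCertificate

end
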